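import Summits.HodgeConjecture.CorCM.Census.DihedralSurfaceTriple

/-!
# The dihedral CM-surface triple in all degrees; powers of `S₂`; the four-factor core — kernel census, sequel

COR-CM (cell `pub-hodgecm2`), count-neutral sequel to `Census/DihedralSurfaceTriple.lean` (the `B¹ = 6`,
`B² = 19 = 15 + 4` census of `Y = S₁ × S₂ × S₁′`).  It records, as finite kernel-decided statements (no named fact,
no geometry, no `sorry`), the combinatorial shadow of the structure theory of the four exceptional Hodge classes of
`Y` worked out in the cell note `HOME/pub-hodgecm2-b09/A6-SCOPING.md` §1 (ask A6 / recommendation R1):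

* §1 `Y` IN ALL DEGREES.  Pohlmann `2p`-sets of `Y` number `1, 6, 19, 28, 19, 6, 1` (`p = 0, …, 6`), of which
  `0, 0, 4, 8, 4, 0, 0` are not stable under complex conjugation `c`.  IDEAL STATEMENT: every non-`c`-stable
  Pohlmann set contains EXACTLY ONE of the four exceptional `4`-sets `E_i` of the first file and its remainder is
  `c`-stable; in degree `3` the eight sets are `E_i ⊔ (a conjugate pair of S₁)` and `E_i ⊔ (a conjugate pair of S₁′)`
  (`8 = 4·2`; no `E_i` is disjoint from a conjugate pair of `S₂`), in degree `4` the four sets are the complements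
  `pts \ E_i ⊇ E_{i+2}`.  ONE-CLASS SHADOW: the `S₁`-traces of `E_0, …, E_3` are the four distinct singletons
  `{(0,i)}`, and `r` permutes the `E_i` cyclically.
* §2 POWERS OF `S₂`.  For `S₂ × S₂ × S₂` and `S₂ × S₂ × S₂′` (`S₂′` the Galois conjugate `r(S₂)`, NOT isogenous to
  `S₂`) every Pohlmann set of every degree is a disjoint union of Pohlmann `2`-sets (conjugate pairs inside a factor
  and "graph" pairs `{(a,i), (b,i+2)}` between isogenous factors): `B^p = 1, 18, 99, 164, 99, 18, 1`, resp.
  `1, 10, 35, 52, 35, 10, 1`, and NO exceptional set in any degree.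
* §3 THE FOUR-FACTOR CORE `S₁ × S₂ × S₁′ × S₂′` (sixteen points): `B¹ = 8`, `B² = 52 = 28 + 24`, the `24`
  exceptional `4`-sets sorted by Künneth multidegree: `(1,2,1,0)·4` (the `E_i` of `Y`), `(1,0,1,2)·4`, `(2,1,0,1)·4`,
  `(0,1,2,1)·4` (the analogous classes of the other three triples) and `(1,1,1,1)·8` = ONE regular `D₄`-orbit (a second
  species); `B³ = 152 = 56 + 96` and every non-`c`-stable Pohlmann `6`-set is (one of the `24`) ⊔ (a conjugate pair).

DICTIONARY (cited, as in the first file; not formalised).  With an eigenbasis `(e_x)_{x ∈ pts}` of `H¹(A, ℚ̄)`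
adapted to the CM action, `B^p(A) ⊗ ℚ̄` has basis the monomials `e_P = ∧_{x ∈ P} e_x` over the `2p`-sets `P` with
`|gP ∩ Φ| = p` for all `g` [cite: Pohlmann1968, Thm 1] (= the tree's `Literature.AlgebraicGeometry.GaoUllmo2025.theorem31`
[cite: GaoUllmo2025, Thm 3.1]); `e_P ∧ e_Q = ± e_{P ⊔ Q}` for disjoint `P, Q` and `0` otherwise, so products of `p`
divisor classes span exactly the `e_P` with `P` a disjoint union of `p` Pohlmann `2`-sets — for `Y` the six conjugate
pairs (`divisorSets_eq`), i.e. "product of divisor classes" = "`c`-stable"; for powers of `S₂` also the graph pairs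
of `Hom(S₂, S₂) ⊗ ℚ = K₂` (§2).  Consequences drawn in the cell note (over `ℚ` by descent): `B^•(Y) = Div^•(Y) +
E · Div^•(Y)` with `E := B²_exc(Y)` of dimension `4`, so HC for `Y` in every degree ⟺ `E` algebraic; and `E ⊗ ℂ` is
the regular representation of `K₁ ⊗ ℂ` under `u_x^* = (ι₁(x), id, id)^*`, so ONE non-zero algebraic class in the
`K₁`-line `E` suffices.  §2 is the kernel instance of [cite: Gordon1999HodgeAVSurvey, Thm 7.5 (Hazama, Murty)] ("rank `Hg(S₂) =
dim S₂` ⇒ powers of `S₂` carry only products of divisor classes") plus the mixed case `S₂² × S₂′` (not a power).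
Conventions = first file: factor `0 = S₁` (type `{0,1}` of `K₁`), `1 = S₂` (type `{0,3}` of `K₂`, `s : i ↦ 1 - i`),
`2 = S₁′` (type `{1,2}` of `K₁`); the cell note's labels differ by `i ↦ i + 1` on `K₂` (its `S₂`/`S₂′` are this
file's `S₂′`/`S₂`; all statements are symmetric under this swap).

## References
* [Pohlmann1968] H. Pohlmann, Algebraic cycles on abelian varieties of complex multiplication type, Ann. of Math. 88 (1968) 161–180, Thm 1.
* [GaoUllmo2025] Z. Gao, E. Ullmo, J. Inst. Math. Jussieu 25 (2025) = arXiv:2411.12249, Thm 3.1.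
* [Gordon1999HodgeAVSurvey] B. B. Gordon, A survey of the Hodge conjecture for abelian varieties, Appendix B in J. D. Lewis, A survey of the Hodge conjecture, 2nd ed., CRM Monograph Series 10, AMS 1999 = arXiv:alg-geom/9709030, Thm 7.5.
* [MoonenZarhin1999] B. Moonen, Yu. Zarhin, Hodge classes on abelian varieties of low dimension, Math. Ann. 315 (1999) 711–733, section "Hodge groups of simple abelian surfaces of CM-type".

## Provenance
Kernel cost: `decide +kernel` over the `2¹²` subsets of twelve points (§1, §2) and the `4`- and `6`-subsets of
sixteen points (§3), eight group elements each (≈ 75 s).  Oracle (exact python, < 1 s, tree conventions): session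
folder `prover-pub-hodgecm2-b20-g11-0/work/census_oracle.py` = `HOME/pub-hodgecm2-b09/d4_census.py` relabelled.
-/

namespace Summit.HodgeConjecture.CorCM.Census.DihedralSurfaceTriple

open Finset

/-! ## §1 The triple `Y = S₁ × S₂ × S₁′` in all degrees -/

/-- The Pohlmann `2p`-sets of `Y`: `2p`-subsets `P` of the twelve points with `|gP ∩ Φ| = p` for all `g ∈ D₄`
(a basis of `B^p(Y) ⊗ ℚ̄`). [cite: GaoUllmo2025, Thm 3.1] -/
def hodgeSetsDeg (p : ℕ) : Finset (Finset Pt) := (pts.powersetCard (2 * p)).filter fun P => eq32 p P = true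

/-- Stability under complex conjugation `c = r²` (`act 2 false`), as a Boolean test; for `Y` a `c`-stable even
set is a disjoint union of conjugate pairs, i.e. its monomial is a product of divisor classes. [folklore] -/
def cStable (P : Finset Pt) : Bool := decide (∀ x ∈ P, act 2 false x ∈ P)

/-- Künneth multidegree of a monomial: number of points on the factors `S₁`, `S₂`, `S₁′`. [folklore] -/
def mdeg (P : Finset Pt) : ℕ × ℕ × ℕ :=
  ((P.filter fun x => x.1 = 0).card, (P.filter fun x => x.1 = 1).card, (P.filter fun x => x.1 = 2).card)

/-- The exceptional family `E_i = {(0,i), (1,i), (1,i+1), (2,i)}` = `e_i(S₁) ⊗ (e_i ∧ e_{i+1})(S₂) ⊗ e_i(S₁′)`,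
`i ∈ ℤ/4` (the four sets of `exceptional_eq`). [cite: GaoUllmo2025, Thm 3.1] -/
def excFamily (i : ZMod 4) : Finset Pt := {((0 : Fin 3), i), (1, i), (1, i + 1), (2, i)}

/-- Degree two of this file is the census of the first file. [folklore] -/
theorem hodgeSetsDeg_two : hodgeSetsDeg 2 = hodgeSets := rfl

/-- The four exceptional `4`-sets of the first file are the family `E_i`. [cite: GaoUllmo2025, Thm 3.1] -/
theorem exceptional_eq_image_excFamily : exceptional = univ.image excFamily := by
  decide +kernel

/-- `D₄` permutes the `E_i`: `r^j` sends `E_i` to `E_{i+j}` and `r^j s` sends `E_i` to `E_{j-i}`; in particular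
`{E_i}` is one Galois orbit (so `E` is defined over `ℚ`) on which `⟨r⟩` acts simply transitively. [folklore] -/
theorem excFamily_orbit : ∀ i j : ZMod 4,
    (excFamily i).image (act j false) = excFamily (i + j) ∧ (excFamily i).image (act j true) = excFamily (j - i) := by
  decide +kernel

/-- **One-class shadow.** The `S₁`-traces of the four exceptional sets are the four distinct singletons `{(0,i)}`
(likewise for `S₁′`), every `S₂`-trace is an adjacent pair `{i, i+1}`: under `u_x^* = (ι₁(x), id, id)^*` the monomial
of `E_i` has character `σ_i`, so `E ⊗ ℂ` is the regular `K₁ ⊗ ℂ`-module (A6-SCOPING §1 (1.3)). [cite: GaoUllmo2025, Thm 3.1] -/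
theorem exceptional_traces :
    exceptional.image (fun P => P.filter fun x => x.1 = 0) =
      univ.image (fun i : ZMod 4 => ({((0 : Fin 3), i)} : Finset Pt)) ∧
    exceptional.image (fun P => P.filter fun x => x.1 = 2) =
      univ.image (fun i : ZMod 4 => ({((2 : Fin 3), i)} : Finset Pt)) ∧
    exceptional.image (fun P => P.filter fun x => x.1 = 1) =
      univ.image (fun i : ZMod 4 => ({((1 : Fin 3), i), (1, i + 1)} : Finset Pt)) ∧
    (exceptional.image fun P => P.filter fun x => x.1 = 0).card = 4 := by
  decide +kernel

set_option maxRecDepth 8000 in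
set_option maxHeartbeats 4000000 in
/-- **All-degree census of `Y`.** `dim B^p(Y) = 1, 6, 19, 28, 19, 6, 1` and the numbers of Pohlmann `2p`-sets that
are NOT products of divisor classes are `0, 0, 4, 8, 4, 0, 0` (`p = 0, …, 6`). [cite: GaoUllmo2025, Thm 3.1] -/
theorem card_hodgeSetsDeg :
    (List.range 7).map (fun p => (hodgeSetsDeg p).card) = [1, 6, 19, 28, 19, 6, 1] ∧
    (List.range 7).map (fun p => ((hodgeSetsDeg p).filter fun P => cStable P = false).card) =
      [0, 0, 4, 8, 4, 0, 0] := by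
  decide +kernel

set_option maxRecDepth 8000 in
set_option maxHeartbeats 4000000 in
/-- Poincaré / Hard-Lefschetz shadow: the complement of a Pohlmann `2p`-set satisfies Pohlmann's condition with
multiplicity `6 - p` (no exception in any degree `p ≤ 6`). [cite: Pohlmann1968, Thm 1] -/
theorem compl_pohlmann :
    ∀ p ∈ Finset.range 7, ((hodgeSetsDeg p).filter fun P => eq32 (6 - p) (pts \ P) = false) = ∅ := by
  decide +kernel

set_option maxRecDepth 8000 in
set_option maxHeartbeats 4000000 in
/-- **Ideal statement.** In every degree, a Pohlmann set of `Y` that is not a product of divisor classes contains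
EXACTLY ONE exceptional `4`-set `E_i`, and the rest of it is `c`-stable (a product of divisor classes) — stated as:
the set of offending Pohlmann `2p`-sets is empty for every `p ≤ 6`.  With the dictionary: `B^•(Y) = Div^•(Y) +
E · Div^•(Y)` — every exceptional Hodge class of `Y`, in any degree, lies in the ideal generated by the
`4`-dimensional space `E = B²_exc(Y)` (cell note A6-SCOPING §1 (1.1)). [cite: GaoUllmo2025, Thm 3.1] -/
theorem excFamily_generates :
    ∀ p ∈ Finset.range 7, ((hodgeSetsDeg p).filter fun P => cStable P = false ∧
      ¬ ((univ.filter fun i : ZMod 4 => excFamily i ⊆ P).card = 1 ∧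
          ∀ i : ZMod 4, excFamily i ⊆ P → cStable (P \ excFamily i) = true)) = ∅ := by
  decide +kernel

set_option maxRecDepth 8000 in
set_option maxHeartbeats 4000000 in
/-- **Degree three: `B³_exc = E · B¹(S₁) ⊕ E · B¹(S₁′)`, `8 = 4 + 4`.** The eight non-`c`-stable Pohlmann `6`-sets
are `E_i ⊔ {(0,i+1),(0,i+3)}` (multidegree `(3,2,1)`) and `E_i ⊔ {(2,i+1),(2,i+3)}` (multidegree `(1,2,3)`); and
`E · NS(S₂) = 0` on the nose: no `E_i` is disjoint from a conjugate pair `{(1,j),(1,j+2)}` of the `S₂`-factor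
(cell note A6-SCOPING §1 (1.1)). [cite: GaoUllmo2025, Thm 3.1] -/
theorem exceptional_deg_three :
    ((hodgeSetsDeg 3).filter fun P => cStable P = false) =
      univ.image (fun i : ZMod 4 => excFamily i ∪ {((0 : Fin 3), i + 1), (0, i + 3)}) ∪
      univ.image (fun i : ZMod 4 => excFamily i ∪ {((2 : Fin 3), i + 1), (2, i + 3)}) ∧
    ((hodgeSetsDeg 3).filter fun P => cStable P = false ∧ mdeg P = (3, 2, 1)).card = 4 ∧
    ((hodgeSetsDeg 3).filter fun P => cStable P = false ∧ mdeg P = (1, 2, 3)).card = 4 ∧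
    (∀ i j : ZMod 4, ¬ Disjoint (excFamily i) ({((1 : Fin 3), j), (1, j + 2)} : Finset Pt)) := by
  decide +kernel

set_option maxRecDepth 8000 in
set_option maxHeartbeats 4000000 in
/-- **Degree four: the `L²`-duals.** The four non-`c`-stable Pohlmann `8`-sets are the complements `pts \ E_i`
(multidegree `(3,2,3)`), and `pts \ E_i = E_{i+2} ⊔ (two conjugate pairs)`. [cite: GaoUllmo2025, Thm 3.1] -/
theorem exceptional_deg_four :
    ((hodgeSetsDeg 4).filter fun P => cStable P = false) = univ.image (fun i : ZMod 4 => pts \ excFamily i) ∧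
    (∀ i : ZMod 4, mdeg (pts \ excFamily i) = (3, 2, 3) ∧ excFamily (i + 2) ⊆ pts \ excFamily i ∧
      cStable ((pts \ excFamily i) \ excFamily (i + 2)) = true) := by
  decide +kernel

/-! ## §2 Powers of `S₂`: `S₂ × S₂ × S₂` and `S₂ × S₂ × S₂′` -/

namespace S2Powers

/-- `rʲ sᶠ ∈ D₄` acting on three `K₂`-factors: `s` is `i ↦ 1 - i` on EVERY factor (the `K₂`-rule of `act`),
`r` is `i ↦ i + 1`. [cite: MoonenZarhin1999, section "Hodge groups of simple abelian surfaces of CM-type"] -/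
def act₂ (j : ZMod 4) (f : Bool) : Pt → Pt
  | (b, i) => (b, (if f then 1 - i else i) + j)

/-- The type of `S₂ × S₂ × S₂`: `{0,3}` on each factor. [folklore] -/
def phiCube : Finset Pt := {((0 : Fin 3), (0 : ZMod 4)), (0, 3), (1, 0), (1, 3), (2, 0), (2, 3)}

/-- The type of `S₂ × S₂ × S₂′`: `{0,3}` on factors `0, 1` and `{0,1}` on factor `2`; `S₂′ := r(S₂)` has type
`r·{0,3} = {0,1}`, which is neither `{0,3}` nor `c·{0,3} = {1,2}`, so `S₂′ ≁ S₂` (two isogeny classes of simple CM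
surfaces with field `K₂`). [cite: MoonenZarhin1999, same section ("in case (2) there are two such isogeny classes")] -/
def phiSqPrime : Finset Pt := {((0 : Fin 3), (0 : ZMod 4)), (0, 3), (1, 0), (1, 3), (2, 0), (2, 1)}

/-- Sanity: both are CM types (each factor's type contains exactly one of `i`, `c·i = i + 2`); the maps `act₂ j f`
satisfy the `D₄` relations and are pairwise distinct; the type `{0,1}` of factor `2` of `phiSqPrime` is not in the
`Aut(K₂) = {1, c}`-orbit `{ {0,3}, {1,2} }` of the type of `S₂`. [folklore] -/
theorem sanity :
    (∀ x : Pt, (x ∈ phiCube ↔ act₂ 2 false x ∉ phiCube) ∧ (x ∈ phiSqPrime ↔ act₂ 2 false x ∉ phiSqPrime)) ∧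
    (∀ x : Pt, act₂ 0 true (act₂ 0 true x) = x ∧ act₂ 1 false (act₂ 3 false x) = x ∧
      act₂ 0 true (act₂ 1 false (act₂ 0 true x)) = act₂ 3 false x) ∧
    (∀ j j' : ZMod 4, ∀ f f' : Bool, (∀ x : Pt, act₂ j f x = act₂ j' f' x) → j = j' ∧ f = f') ∧
    (phiSqPrime.filter fun x => x.1 = 2).image Prod.snd = ({0, 1} : Finset (ZMod 4)) ∧
    ({0, 1} : Finset (ZMod 4)) ≠ {0, 3} ∧ ({0, 1} : Finset (ZMod 4)) ≠ {1, 2} := by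
  decide +kernel

/-- Pohlmann's condition `|gP ∩ Φ| = k` for all `g ∈ D₄`, for the all-`K₂` action. [cite: GaoUllmo2025, Thm 3.1 eq. (3.2)] -/
def isHodge₂ (Φ : Finset Pt) (k : ℕ) (P : Finset Pt) : Bool :=
  decide (∀ g : ZMod 4 × Bool, (P.filter fun x => act₂ g.1 g.2 x ∈ Φ).card = k)

/-- The Pohlmann `2p`-sets for the type `Φ` (a basis of `B^p ⊗ ℚ̄`). [cite: GaoUllmo2025, Thm 3.1] -/
def hodgeSets₂ (Φ : Finset Pt) (p : ℕ) : Finset (Finset Pt) := (pts.powersetCard (2 * p)).filter (isHodge₂ Φ p ·)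

/-- Decomposability into Pohlmann `2`-sets, by structural recursion on a fuel `n ≥ |P|/2`: `P` is empty, or some
Pohlmann `2`-set `{x, y} ⊆ P` can be removed leaving a decomposable set.  `pairDecomp Φ n P = true` therefore says
that the monomial `e_P` is `±` a product of monomials of divisor / graph classes (`B¹ ⊗ ℚ̄`). [folklore] -/
def pairDecomp (Φ : Finset Pt) : ℕ → Finset Pt → Bool
  | 0, P => decide (P = ∅)
  | n + 1, P => decide (P = ∅) ||
      decide (∃ x ∈ P, ∃ y ∈ P, x ≠ y ∧ isHodge₂ Φ 1 {x, y} = true ∧ pairDecomp Φ n ((P.erase x).erase y) = true)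

/-- Soundness of `pairDecomp`: a decomposable set is the disjoint union of a family of Pohlmann `2`-sets. [folklore] -/
theorem exists_pairs_of_pairDecomp (Φ : Finset Pt) :
    ∀ (n : ℕ) (P : Finset Pt), pairDecomp Φ n P = true →
      ∃ M : Finset (Finset Pt), (∀ Q ∈ M, Q.card = 2 ∧ isHodge₂ Φ 1 Q = true) ∧
        (∀ Q ∈ M, ∀ Q' ∈ M, Q ≠ Q' → Disjoint Q Q') ∧ M.biUnion id = P := by
  intro n
  induction n with
  | zero =>
    intro P h
    simp only [pairDecomp, decide_eq_true_eq] at h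
    exact ⟨∅, by simp, by simp, by simp [h]⟩
  | succ n ih =>
    intro P h
    simp only [pairDecomp, Bool.or_eq_true, decide_eq_true_eq] at h
    rcases h with h | ⟨x, hx, y, hy, hxy, hH, hrec⟩
    · exact ⟨∅, by simp, by simp, by simp [h]⟩
    · obtain ⟨M, hM, hdisj, hU⟩ := ih _ hrec
      have hQP : ∀ Q ∈ M, Q ⊆ (P.erase x).erase y := fun Q hQ => by
        rw [← hU]; exact Finset.subset_biUnion_of_mem id hQ
      refine ⟨insert {x, y} M, ?_, ?_, ?_⟩
      · intro Q hQ
        rcases Finset.mem_insert.mp hQ with rfl | hQ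
        · exact ⟨Finset.card_pair hxy, hH⟩
        · exact hM Q hQ
      · intro Q hQ Q' hQ' hne
        have key : ∀ Q ∈ M, Disjoint ({x, y} : Finset Pt) Q := fun Q hQ => by
          rw [Finset.disjoint_left]
          intro z hz hzQ
          have hz' := hQP Q hQ hzQ
          simp only [Finset.mem_insert, Finset.mem_singleton] at hz
          rcases hz with rfl | rfl <;> simp at hz'
        rcases Finset.mem_insert.mp hQ with rfl | hQ <;> rcases Finset.mem_insert.mp hQ' with rfl | hQ'
        · exact (hne rfl).elim
        · exact key Q' hQ'
        · exact (key Q hQ).symm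
        · exact hdisj Q hQ Q' hQ' hne
      · rw [Finset.biUnion_insert, hU]
        ext z
        simp only [id_eq, Finset.mem_union, Finset.mem_insert, Finset.mem_singleton, Finset.mem_erase]
        constructor
        · rintro ((rfl | rfl) | ⟨-, -, hz⟩)
          · exact hx
          · exact hy
          · exact hz
        · intro hz
          by_cases h1 : z = x
          · exact Or.inl (Or.inl h1)
          by_cases h2 : z = y
          · exact Or.inl (Or.inr h2)
          · exact Or.inr ⟨h2, h1, hz⟩

set_option maxRecDepth 8000 in
set_option maxHeartbeats 4000000 in
/-- The Pohlmann `2`-sets (a basis of `B¹ ⊗ ℚ̄ ⊇ (NS ⊕ Hom) ⊗ ℚ̄`): for `S₂³` ALL eighteen pairs `{(a,i),(b,i+2)}`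
(`a = b`: `NS(S₂) ⊗ ℚ̄`, two per factor; `a ≠ b`: the graphs of `Hom(S₂,S₂) ⊗ ℚ = K₂`, four per pair of factors);
for `S₂² × S₂′` the ten pairs `{(a,i),(b,i+2)}` with `a, b ∈ {0,1}` or `a = b = 2` — none between `S₂′` and an
`S₂`-factor (`Hom(S₂, S₂′) = 0`). [cite: GaoUllmo2025, Thm 3.1] -/
theorem hodgeSets₂_one :
    hodgeSets₂ phiCube 1 =
      (univ : Finset (Fin 3 × Fin 3 × ZMod 4)).image (fun t => {(t.1, t.2.2), (t.2.1, t.2.2 + 2)}) ∧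
    (hodgeSets₂ phiCube 1).card = 18 ∧
    hodgeSets₂ phiSqPrime 1 =
      ((univ : Finset (Fin 3 × Fin 3 × ZMod 4)).filter fun t =>
        (t.1 ≠ 2 ∧ t.2.1 ≠ 2) ∨ (t.1 = 2 ∧ t.2.1 = 2)).image (fun t => {(t.1, t.2.2), (t.2.1, t.2.2 + 2)}) ∧
    (hodgeSets₂ phiSqPrime 1).card = 10 := by
  decide +kernel

set_option maxRecDepth 8000 in
set_option maxHeartbeats 4000000 in
/-- **`S₂ × S₂ × S₂` is stably non-degenerate through degree `6` (kernel).** `dim B^p(S₂³) = 1, 18, 99, 164, 99,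
18, 1` and EVERY Pohlmann `2p`-set, `0 ≤ p ≤ 6`, passes `pairDecomp` (the decomposable ones have the same counts),
i.e. is a disjoint union of Pohlmann `2`-sets (`exists_pairs_of_pairDecomp`): all Hodge classes on
`S₂³` are products of divisor classes (cell note A6-SCOPING §1 (1.1); the general theorem is
[cite: Gordon1999HodgeAVSurvey, Thm 7.5]). -/
theorem cube_pairDecomp :
    (List.range 7).map (fun p => (hodgeSets₂ phiCube p).card) = [1, 18, 99, 164, 99, 18, 1] ∧
    (List.range 7).map (fun p => ((hodgeSets₂ phiCube p).filter fun P => pairDecomp phiCube p P = true).card) =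
      [1, 18, 99, 164, 99, 18, 1] := by
  decide +kernel

set_option maxRecDepth 8000 in
set_option maxHeartbeats 4000000 in
/-- **`S₂ × S₂ × S₂′` carries no exceptional class in any degree (kernel).** `dim B^p = 1, 10, 35, 52, 35, 10, 1`
and every Pohlmann `2p`-set, `0 ≤ p ≤ 6`, passes `pairDecomp`, i.e. is a disjoint union of Pohlmann `2`-sets
(cell note A6-SCOPING §1 (1.1);
not an instance of [cite: Gordon1999HodgeAVSurvey, Thm 7.5], which is about powers of ONE variety). -/
theorem sqPrime_pairDecomp :
    (List.range 7).map (fun p => (hodgeSets₂ phiSqPrime p).card) = [1, 10, 35, 52, 35, 10, 1] ∧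
    (List.range 7).map (fun p => ((hodgeSets₂ phiSqPrime p).filter fun P => pairDecomp phiSqPrime p P = true).card) =
      [1, 10, 35, 52, 35, 10, 1] := by
  decide +kernel

end S2Powers

/-! ## §3 The four-factor core `S₁ × S₂ × S₁′ × S₂′` -/

namespace FourCore

/-- The sixteen points (factor, embedding index); factors `0 = S₁`, `1 = S₂`, `2 = S₁′`, `3 = S₂′`. [folklore] -/
abbrev Pt4 : Type := Fin 4 × ZMod 4

/-- `rʲ sᶠ` acting on the four factors: `s` is `i ↦ -i` on the `K₁`-factors `0, 2` and `i ↦ 1 - i` on the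
`K₂`-factors `1, 3`. [cite: MoonenZarhin1999, section "Hodge groups of simple abelian surfaces of CM-type"] -/
def act4 (j : ZMod 4) (f : Bool) : Pt4 → Pt4
  | (b, i) => (b, (if f then (if b = 1 ∨ b = 3 then 1 - i else -i) else i) + j)

/-- The type of the core: `{0,1} ⊔ {0,3} ⊔ {1,2} ⊔ {0,1}` (`S₂′ = r(S₂)` of type `r·{0,3} = {0,1}`). [folklore] -/
def phi4 : Finset Pt4 := {((0 : Fin 4), (0 : ZMod 4)), (0, 1), (1, 0), (1, 3), (2, 1), (2, 2), (3, 0), (3, 1)}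

/-- All sixteen points. [folklore] -/
def pts4 : Finset Pt4 := univ
/-- Sanity: `phi4` is a CM type and the eight maps `act4 j f` are a faithful `D₄`-action. [folklore] -/
theorem sanity4 : (∀ x : Pt4, (x ∈ phi4 ↔ act4 2 false x ∉ phi4) ∧ act4 0 true (act4 0 true x) = x ∧
      act4 1 false (act4 3 false x) = x ∧ act4 0 true (act4 1 false (act4 0 true x)) = act4 3 false x) ∧
    (∀ j j' : ZMod 4, ∀ f f' : Bool, (∀ x : Pt4, act4 j f x = act4 j' f' x) → j = j' ∧ f = f') := by
  decide +kernel

/-- Pohlmann's condition for the core. [cite: GaoUllmo2025, Thm 3.1 eq. (3.2)] -/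
def isHodge4 (k : ℕ) (P : Finset Pt4) : Bool :=
  decide (∀ g : ZMod 4 × Bool, (P.filter fun x => act4 g.1 g.2 x ∈ phi4).card = k)

/-- The Pohlmann `2p`-sets of the core. [cite: GaoUllmo2025, Thm 3.1] -/
def hodgeSets4 (p : ℕ) : Finset (Finset Pt4) := (pts4.powersetCard (2 * p)).filter fun P => isHodge4 p P = true

/-- `c`-stability. [folklore] -/
def cStable4 (P : Finset Pt4) : Bool := decide (∀ x ∈ P, act4 2 false x ∈ P)

/-- Künneth multidegree on `S₁ × S₂ × S₁′ × S₂′`. [folklore] -/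
def mdeg4 (P : Finset Pt4) : ℕ × ℕ × ℕ × ℕ :=
  ((P.filter fun x => x.1 = 0).card, (P.filter fun x => x.1 = 1).card,
   (P.filter fun x => x.1 = 2).card, (P.filter fun x => x.1 = 3).card)

/-- The eight conjugate pairs. [folklore] -/
def conjPairs4 : Finset (Finset Pt4) := pts4.image fun x => {x, act4 2 false x}

/-- The `24` exceptional `4`-sets of the core, as five explicit families: the `E_i` of the triples
`(S₁,S₂,S₁′)`, `(S₁,S₁′,S₂′)`, `(S₁,S₂,S₂′)`, `(S₂,S₁′,S₂′)` and the second species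
`W = D₄ · {(0,0),(1,0),(2,3),(3,3)}` of multidegree `(1,1,1,1)`. [cite: GaoUllmo2025, Thm 3.1] -/
def excFour : Finset (Finset Pt4) :=
  univ.image (fun i : ZMod 4 => ({((0 : Fin 4), i), (1, i), (1, i + 1), (2, i)} : Finset Pt4)) ∪
  univ.image (fun i : ZMod 4 => ({((0 : Fin 4), i), (2, i + 2), (3, i + 2), (3, i + 3)} : Finset Pt4)) ∪
  univ.image (fun i : ZMod 4 => ({((0 : Fin 4), i), (0, i + 1), (1, i + 1), (3, i + 3)} : Finset Pt4)) ∪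
  univ.image (fun i : ZMod 4 => ({((1 : Fin 4), i), (2, i), (2, i + 3), (3, i)} : Finset Pt4)) ∪
  univ.image (fun g : ZMod 4 × Bool => ({((0 : Fin 4), (0 : ZMod 4)), (1, 0), (2, 3), (3, 3)} : Finset Pt4).image
    (act4 g.1 g.2))

set_option maxRecDepth 8000 in
set_option maxHeartbeats 4000000 in
/-- **Degree one of the core**: the Pohlmann `2`-sets are exactly the eight conjugate pairs (`B¹ = 8 = Σ ρ`, no
graph pairs: the four surfaces are pairwise non-isogenous). [cite: GaoUllmo2025, Thm 3.1] -/
theorem hodgeSets4_one : hodgeSets4 1 = conjPairs4 ∧ conjPairs4.card = 8 := by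
  decide +kernel

set_option maxRecDepth 8000 in
set_option maxHeartbeats 4000000 in
/-- **Degree two of the core: `B² = 52 = 28 + 24`.** The `28 = C(8,2)` `c`-stable Pohlmann `4`-sets are the unions
of two distinct conjugate pairs; the `24` others are `excFour`, with species counts by multidegree
`(1,2,1,0)·4, (1,0,1,2)·4, (2,1,0,1)·4, (0,1,2,1)·4, (1,1,1,1)·8`, the last being ONE regular `D₄`-orbit
(cell note A6-SCOPING §1 (1.1), "second species `W`"). [cite: GaoUllmo2025, Thm 3.1] -/
theorem hodgeSets4_two :
    (hodgeSets4 2).card = 52 ∧ ((hodgeSets4 2).filter fun P => cStable4 P = true).card = 28 ∧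
    ((hodgeSets4 2).filter fun P => cStable4 P = true) =
      ((conjPairs4 ×ˢ conjPairs4).filter fun q => q.1 ≠ q.2).image (fun q => q.1 ∪ q.2) ∧
    ((hodgeSets4 2).filter fun P => cStable4 P = false) = excFour ∧ excFour.card = 24 ∧
    (excFour.filter fun P => mdeg4 P = (1, 2, 1, 0)).card = 4 ∧
    (excFour.filter fun P => mdeg4 P = (1, 0, 1, 2)).card = 4 ∧
    (excFour.filter fun P => mdeg4 P = (2, 1, 0, 1)).card = 4 ∧
    (excFour.filter fun P => mdeg4 P = (0, 1, 2, 1)).card = 4 ∧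
    (excFour.filter fun P => mdeg4 P = (1, 1, 1, 1)) =
      univ.image (fun g : ZMod 4 × Bool =>
        ({((0 : Fin 4), (0 : ZMod 4)), (1, 0), (2, 3), (3, 3)} : Finset Pt4).image (act4 g.1 g.2)) ∧
    (excFour.filter fun P => mdeg4 P = (1, 1, 1, 1)).card = 8 := by
  decide +kernel

set_option maxRecDepth 8000 in
set_option maxHeartbeats 4000000 in
/-- The species `(1,2,1,0)` of the core is the family `E_i` of `Y` under the inclusion of the first three factors.
[cite: GaoUllmo2025, Thm 3.1] -/
theorem excFour_species_triple :
    (excFour.filter fun P => mdeg4 P = (1, 2, 1, 0)) =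
      univ.image (fun i : ZMod 4 => (excFamily i).image fun x => (x.1.castSucc, x.2)) := by
  decide +kernel

set_option maxRecDepth 8000 in
set_option maxHeartbeats 4000000 in
/-- **Degree three of the core: `B³ = 152 = 56 + 96`**, and both species generate: every non-`c`-stable Pohlmann
`6`-set of the core is (one of the `24` exceptional `4`-sets) ⊔ (a conjugate pair) — stated as: no non-`c`-stable
Pohlmann `6`-set fails to contain a member of `excFour` with `c`-stable remainder. [cite: GaoUllmo2025, Thm 3.1] -/
theorem hodgeSets4_three :
    (hodgeSets4 3).card = 152 ∧ ((hodgeSets4 3).filter fun P => cStable4 P = true).card = 56 ∧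
    ((hodgeSets4 3).filter fun P => cStable4 P = false ∧
      (excFour.filter fun E => E ⊆ P ∧ cStable4 (P \ E) = true) = ∅) = ∅ := by
  decide +kernel

end FourCore

end Summit.HodgeConjecture.CorCM.Census.DihedralSurfaceTriple
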